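import Literature.Analysis.Fourier.ChirpSymbolCalculus
import HarnessLib

/-!
# Super-Nyquist chirp phases and their symbol families

The setting of the non-stationary-phase analysis of chirped sampling (`ChirpOscillatory.lean`,
`ChirpAliasKernel.lean`): a *chirp phase* (`ChirpPhase φ H L Cφ`) is a smooth real `φ` with
`φ' ≥ L > 0` on `[H, ∞)` (`H ≥ 1`) and symbol bounds `|φ^{(j)}(t)| ≤ C_j t^{1-j} log(t+2)`
(`j ≥ 1`), e.g. the arch density `φ' = (1/2π) log(t/2π)`. We record the uniform symbol families it
generates: the shifted slopes `ε + φ'` (order `0`), their reciprocals (order `0`, for `|ε| < L`),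
`φ''` and `φ''/φ'²` (order `-1`). Source: Stein, *Harmonic Analysis* (1993), VIII §1;
Hörmander, *ALPDO I*, §7.7. Everything is proved; the only definition is the hypothesis bundle
`ChirpPhase` (a predicate, not a named fact).
-/

noncomputable section

open Set Filter MeasureTheory
open scoped Topology ContDiff Real

namespace Literature.Analysis.Fourier

variable {ι : Type*}

/-! ## The phase -/

/-- A super-Nyquist chirp phase: `φ` smooth on `ℝ`, `φ' ≥ L > 0` on `[H, ∞)` (`H ≥ 1`), with
symbol bounds `|φ^{(j)}(t)| ≤ C_j t^{1-j} log(t+2)` for `j ≥ 1`, `t ≥ H`. [folklore] -/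
structure ChirpPhase (φ : ℝ → ℝ) (H L : ℝ) (Cφ : ℕ → ℝ) : Prop where
  one_le : 1 ≤ H
  pos : 0 < L
  smooth : ContDiff ℝ ∞ φ
  deriv_ge : ∀ t, H ≤ t → L ≤ deriv φ t
  symb : ∀ (j : ℕ) (t : ℝ), 1 ≤ j → H ≤ t →
    |iteratedDeriv j φ t| ≤ Cφ j * t ^ (1 - (j : ℝ)) * Real.log (t + 2)

namespace ChirpPhase

variable {φ : ℝ → ℝ} {H L : ℝ} {Cφ : ℕ → ℝ}

/-- `φ` is differentiable. [folklore] -/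
theorem hasDerivAt (hφ : ChirpPhase φ H L Cφ) (t : ℝ) : HasDerivAt φ (deriv φ t) t :=
  ((hφ.smooth.differentiable (by simp)) t).hasDerivAt

/-- `φ'` is smooth. [folklore] -/
theorem contDiff_deriv (hφ : ChirpPhase φ H L Cφ) : ContDiff ℝ ∞ (deriv φ) :=
  (contDiff_infty_iff_deriv.1 hφ.smooth).2

/-- The symbol bound with a non-negative constant, on the open half-line. [folklore] -/
theorem abs_iteratedDeriv_le (hφ : ChirpPhase φ H L Cφ) {j : ℕ} {t : ℝ} (hj : 1 ≤ j)
    (ht : H < t) :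
    |iteratedDeriv j φ t| ≤ max (Cφ j) 0 * t ^ (1 - (j : ℝ)) * Real.log (t + 2) := by
  refine (hφ.symb j t hj ht.le).trans ?_
  have h1 : 0 ≤ t ^ (1 - (j : ℝ)) := Real.rpow_nonneg (by linarith [hφ.one_le]) _
  have h2 : 0 ≤ Real.log (t + 2) := Real.log_nonneg (by linarith [hφ.one_le])
  have : 0 ≤ t ^ (1 - (j : ℝ)) * Real.log (t + 2) := mul_nonneg h1 h2
  nlinarith [le_max_left (Cφ j) 0]

/-- **The shifted slopes `ε_i + φ'` (`|ε_i| ≤ ε₀`) are a uniform symbol family of order `0`.**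
[folklore] -/
theorem symBnd_const_add_deriv (hφ : ChirpPhase φ H L Cφ) (S : Set ι) (ε : ι → ℝ) {ε₀ : ℝ}
    (hε₀ : 0 ≤ ε₀) (hε : ∀ i ∈ S, |ε i| ≤ ε₀) (R : ℕ) :
    SymBnd S H 0 R (fun i τ => ε i + deriv φ τ) := by
  intro r _
  rcases r with _ | r
  · refine ⟨ε₀ + max (Cφ 1) 0, by positivity, 1, fun i hi τ hτ => ?_⟩
    have hτ1 : 1 ≤ τ := hφ.one_le.trans hτ.le
    have hlog := one_le_log_add_two hτ1
    have h1 := hφ.abs_iteratedDeriv_le (le_refl 1) hτ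
    simp only [iteratedDeriv_one, Nat.cast_one, sub_self, Real.rpow_zero, mul_one] at h1
    rw [iteratedDeriv_zero, Nat.cast_zero, sub_zero, Real.rpow_zero, mul_one, pow_one]
    calc |ε i + deriv φ τ| ≤ |ε i| + |deriv φ τ| := abs_add_le _ _
      _ ≤ ε₀ * 1 + max (Cφ 1) 0 * Real.log (τ + 2) := by rw [mul_one]; exact add_le_add (hε i hi) h1
      _ ≤ ε₀ * Real.log (τ + 2) + max (Cφ 1) 0 * Real.log (τ + 2) := by gcongr
      _ = (ε₀ + max (Cφ 1) 0) * Real.log (τ + 2) := by ring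
  · refine ⟨max (Cφ (r + 2)) 0, le_max_right _ _, 1, fun i hi τ hτ => ?_⟩
    have h1 := hφ.abs_iteratedDeriv_le (by omega : 1 ≤ r + 2) hτ
    rw [iteratedDeriv_const_add (by omega), ← iteratedDeriv_succ', pow_one]
    convert h1 using 3
    push_cast
    ring

/-- The shifted slopes are smooth. [folklore] -/
theorem smoothFam_const_add_deriv (hφ : ChirpPhase φ H L Cφ) (S : Set ι) (ε : ι → ℝ) :
    SmoothFam S H (fun i τ => ε i + deriv φ τ) :=
  fun _ _ => (contDiff_const.add hφ.contDiff_deriv).contDiffOn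

/-- Lower bound `ε_i + φ' ≥ L - ε₀` on `(H, ∞)`. [folklore] -/
theorem const_add_deriv_ge (hφ : ChirpPhase φ H L Cφ) {S : Set ι} {ε : ι → ℝ} {ε₀ : ℝ}
    (hε : ∀ i ∈ S, |ε i| ≤ ε₀) : ∀ i ∈ S, ∀ τ, H < τ → L - ε₀ ≤ ε i + deriv φ τ := by
  intro i hi τ hτ
  have h1 := hφ.deriv_ge τ hτ.le
  have h2 := hε i hi
  have h3 : -ε₀ ≤ ε i := by linarith [neg_abs_le (ε i)]
  linarith

/-- **The reciprocal slopes `1/(ε_i + φ')` are a uniform symbol family of order `0`** when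
`ε₀ < L`. [folklore] -/
theorem symBnd_inv_const_add_deriv (hφ : ChirpPhase φ H L Cφ) (S : Set ι) (ε : ι → ℝ) {ε₀ : ℝ}
    (hε₀ : 0 ≤ ε₀) (hεL : ε₀ < L) (hε : ∀ i ∈ S, |ε i| ≤ ε₀) (R : ℕ) :
    SymBnd S H 0 R (fun i τ => (ε i + deriv φ τ)⁻¹) :=
  SymBnd.inv hφ.one_le (hφ.smoothFam_const_add_deriv S ε)
    (hφ.symBnd_const_add_deriv S ε hε₀ hε) (sub_pos.mpr hεL) (hφ.const_add_deriv_ge hε) R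

/-- The reciprocal slopes are smooth on `(H, ∞)`. [folklore] -/
theorem smoothFam_inv_const_add_deriv (hφ : ChirpPhase φ H L Cφ) (S : Set ι) (ε : ι → ℝ)
    {ε₀ : ℝ} (hεL : ε₀ < L) (hε : ∀ i ∈ S, |ε i| ≤ ε₀) :
    SmoothFam S H (fun i τ => (ε i + deriv φ τ)⁻¹) :=
  (hφ.smoothFam_const_add_deriv S ε).inv fun i hi τ hτ =>
    ((sub_pos.mpr hεL).trans_le (hφ.const_add_deriv_ge hε i hi τ hτ)).ne'

/-- `φ''` is a uniform (constant) symbol family of order `-1`. [folklore] -/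
theorem symBnd_deriv_deriv (hφ : ChirpPhase φ H L Cφ) (S : Set ι) (R : ℕ) :
    SymBnd S H (-1) R (fun _ τ => deriv (deriv φ) τ) := by
  intro r _
  refine ⟨max (Cφ (r + 2)) 0, le_max_right _ _, 1, fun i hi τ hτ => ?_⟩
  have h1 := hφ.abs_iteratedDeriv_le (by omega : 1 ≤ r + 2) hτ
  show |iteratedDeriv r (deriv (deriv φ)) τ| ≤ _
  rw [← iteratedDeriv_succ', ← iteratedDeriv_succ', pow_one]
  convert h1 using 3
  push_cast
  ring

/-- `1/φ'` is a uniform (constant) symbol family of order `0`. [folklore] -/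
theorem symBnd_inv_deriv (hφ : ChirpPhase φ H L Cφ) (S : Set ι) (R : ℕ) :
    SymBnd S H 0 R (fun _ τ => (deriv φ τ)⁻¹) := by
  have := hφ.symBnd_inv_const_add_deriv S (fun _ => (0:ℝ)) le_rfl hφ.pos
    (fun i _ => by simp) R
  simpa using this

/-- `1/φ'` is smooth on `(H, ∞)`. [folklore] -/
theorem contDiffOn_inv_deriv (hφ : ChirpPhase φ H L Cφ) :
    ContDiffOn ℝ ∞ (fun τ => (deriv φ τ)⁻¹) (Ioi H) :=
  hφ.contDiff_deriv.contDiffOn.inv fun τ hτ => (hφ.pos.trans_le (hφ.deriv_ge τ (le_of_lt hτ))).ne'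

/-- `φ''/φ'²` is a uniform (constant) symbol family of order `-1`. [folklore] -/
theorem symBnd_deriv_deriv_div (hφ : ChirpPhase φ H L Cφ) (S : Set ι) (R : ℕ) :
    SymBnd S H (-1) R (fun _ τ => deriv (deriv φ) τ * (deriv φ τ)⁻¹ * (deriv φ τ)⁻¹) := by
  have hv : SmoothFam S H (fun (_ : ι) τ => (deriv φ τ)⁻¹) := fun _ _ => hφ.contDiffOn_inv_deriv
  have h2 : SmoothFam S H (fun (_ : ι) τ => deriv (deriv φ) τ) :=
    fun _ _ => (contDiff_infty_iff_deriv.1 hφ.contDiff_deriv).2.contDiffOn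
  have := ((hφ.symBnd_deriv_deriv S R).mul hφ.one_le h2 hv (hφ.symBnd_inv_deriv S R)).mul
    hφ.one_le (h2.mul hv) hv (hφ.symBnd_inv_deriv S R)
  simpa using this

end ChirpPhase

end Literature.Analysis.Fourier
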